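import Literature.Geometry.Kaehler.KaehlerFormPower
import Mathlib.Analysis.InnerProductSpace.Calculus
import Mathlib.Analysis.Calculus.DifferentialForm.Basic
import Mathlib.Analysis.Calculus.Deriv.Comp
import HarnessLib

/-!
# Radial test forms `h(|x-a|²) ι_{x-a} ω^p/p!` and their exterior derivative on complex frames

The ONE family of test forms needed for the monotonicity of the mass ratio of an analytic set
(`Literature.Geometry.Kaehler.Chirka1989_massRatio_monotoneOn`, [Chirka1989, §15.1 Prop. 1]), in
the cut-off form of the argument (no Stokes formula on spherical shells): for a profile
`h : ℝ → ℝ` and a centre `a`,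

  `β_h(x) = h(‖x - a‖²) · ι_{x-a} K_{q+1}`,  `K_{q+1} = ω^{q+1}/(q+1)!`
(`Literature/Geometry/Kaehler/KaehlerFormPower.lean`), a smooth `(2q+1)`-form which is a test form
on `Ω` as soon as `h` is smooth and vanishes on `[R², ∞)` with `B̄(a, R) ⊆ Ω`
(`radialTestForm`). Its exterior derivative (Mathlib's `extDeriv`), evaluated on the real frame
`(u₀, I u₀, …)` of a unitary `(q+1)`-frame `u` — the orientation of a complex tangent plane — is

  `dβ_h(x)(u₀, I u₀, …) = 2 h'(ρ) Σ_j |⟪u_j, x - a⟫|² + 2(q+1) h(ρ)`,  `ρ = ‖x - a‖²`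
(`extDeriv_radialForm_apply_complexFrame`): `d(h(ρ) ι_E K) = h'(ρ) dρ ∧ ι_E K + h(ρ) · 2(q+1) K`,
with `K(ξ) = 1` (Wirtinger) and `(dρ ∧ ι_E K)(ξ) = 2 |(x-a)_T|²`, the squared norm of the
tangential part — the pointwise content of
`R^{-2p} ∫_{A_R} ω^p - r^{-2p} ∫_{A_r} ω^p = ∫_{A_R ∖ A_r} ω₀^p ≥ 0` [Chirka1989, §15.1].
Everything is proved from Mathlib; no named facts.

## References

* E. M. Chirka, *Complex Analytic Sets*, Kluwer 1989, §15.1 (proof of Prop. 1) [Chirka1989].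
* H. Federer, *Geometric Measure Theory*, Springer 1969, 4.1.6–4.1.7 (exterior derivative, test
  forms) [Federer1969].
-/

noncomputable section

open scoped InnerProductSpace ComplexConjugate
open Fin Finset

namespace Literature.Geometry.Kaehler

variable {V : Type*} [NormedAddCommGroup V] [InnerProductSpace ℂ V]


section Radial

open scoped ContDiff Topology
open Metric Set

variable {q : ℕ}

/-- **The radial `(2q+1)`-form** `β_h(x) = h(‖x - a‖²) · ι_{x-a}(ω^{q+1}/(q+1)!)` (interior product of
the radial vector with the divided power of the Kähler form, weighted by a profile `h` of
`|x - a|²`): the primitive `d(ι_E ω^p/p!) = 2p ω^p/p!` behind the monotonicity formula, cut off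
radially. [cite: Chirka1989, §15.1 (proof of Prop. 1)] -/
def radialForm (q : ℕ) (h : ℝ → ℝ) (a : V) : V → V [⋀^Fin (2 * q + 1)]→L[ℝ] ℝ :=
  fun x => h (‖x - a‖ ^ 2) • (kaehlerPow (q + 1) : V [⋀^Fin (2 * q + 1 + 1)]→L[ℝ] ℝ).curryLeft (x - a)

/-- Unfolding lemma for `radialForm`. [folklore] -/
theorem radialForm_apply (h : ℝ → ℝ) (a x : V) (v : Fin (2 * q + 1) → V) :
    radialForm q h a x v = h (‖x - a‖ ^ 2) * kaehlerPow (q + 1) (Matrix.vecCons (x - a) v) := by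
  simp [radialForm, ContinuousAlternatingMap.curryLeft_apply_apply]

/-- `β_h` is smooth when `h` is. [folklore] -/
theorem contDiff_radialForm {h : ℝ → ℝ} {n : WithTop ℕ∞} (hh : ContDiff ℝ n h) (q : ℕ) (a : V) :
    ContDiff ℝ n (radialForm q h a) := by
  refine ContDiff.smul (hh.comp ((contDiff_norm_sq ℂ).comp (contDiff_id.sub contDiff_const))) ?_
  exact ((kaehlerPow (q + 1) : V [⋀^Fin (2 * q + 1 + 1)]→L[ℝ] ℝ).curryLeft.contDiff).comp
    (contDiff_id.sub contDiff_const)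

/-- `β_h(x) = 0` where the profile vanishes: if `h = 0` on `[R², ∞)` and `R ≤ ‖x - a‖`, `0 ≤ R`.
[folklore] -/
theorem radialForm_eq_zero {h : ℝ → ℝ} {R : ℝ} (hR0 : 0 ≤ R) (hR : ∀ t, R ^ 2 ≤ t → h t = 0)
    {a x : V} (hx : R ≤ ‖x - a‖) : radialForm q h a x = 0 := by
  have : h (‖x - a‖ ^ 2) = 0 := hR _ (pow_le_pow_left₀ hR0 hx 2)
  simp [radialForm, this]

/-- The support of `β_h` lies in the closed ball `B̄(a, R)` if `h = 0` on `[R², ∞)`. [folklore] -/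
theorem tsupport_radialForm_subset {h : ℝ → ℝ} {R : ℝ} (hR0 : 0 ≤ R)
    (hR : ∀ t, R ^ 2 ≤ t → h t = 0) (a : V) :
    tsupport (radialForm q h a) ⊆ closedBall a R := by
  refine closure_minimal (fun x hx => ?_) isClosed_closedBall
  by_contra hxa
  refine hx (radialForm_eq_zero hR0 hR ?_)
  rw [mem_closedBall, dist_eq_norm] at hxa
  exact (not_le.1 hxa).le

/-- `β_h` has compact support (finite-dimensional `V`) if `h = 0` on `[R², ∞)`. [folklore] -/
theorem hasCompactSupport_radialForm [FiniteDimensional ℂ V] {h : ℝ → ℝ} {R : ℝ} (hR0 : 0 ≤ R)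
    (hR : ∀ t, R ^ 2 ≤ t → h t = 0) (a : V) : HasCompactSupport (radialForm q h a) := by
  haveI : ProperSpace V := FiniteDimensional.proper ℂ V
  refine HasCompactSupport.intro (isCompact_closedBall a R) fun x hx => radialForm_eq_zero hR0 hR ?_
  rw [mem_closedBall, dist_eq_norm] at hx
  exact (not_le.1 hx).le

/-- **The radial test form** `β_h ∈ 𝓓^{2q+1}(Ω)`: for a smooth profile `h` vanishing on `[R², ∞)`
and a closed ball `B̄(a, R) ⊆ Ω`, the form `h(‖x-a‖²) ι_{x-a} K_{q+1}` is a test `(2q+1)`-form on `Ω`.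
[cite: Chirka1989, §15.1 (proof of Prop. 1)] -/
def radialTestForm [FiniteDimensional ℂ V] (Ω : TopologicalSpace.Opens V) (q : ℕ) (h : ℝ → ℝ)
    (hh : ContDiff ℝ ∞ h) (a : V) (R : ℝ) (hR0 : 0 ≤ R) (hR : ∀ t, R ^ 2 ≤ t → h t = 0)
    (hΩ : closedBall a R ⊆ (Ω : Set V)) :
    Literature.Geometry.GeometricMeasureTheory.TestForm Ω (2 * q + 1) :=
  ⟨radialForm q h a, contDiff_radialForm hh q a, hasCompactSupport_radialForm hR0 hR a,
    (tsupport_radialForm_subset hR0 hR a).trans hΩ⟩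

/-- The underlying function of `radialTestForm`. [folklore] -/
@[simp] theorem coe_radialTestForm [FiniteDimensional ℂ V] (Ω : TopologicalSpace.Opens V) (q : ℕ)
    (h : ℝ → ℝ) (hh : ContDiff ℝ ∞ h) (a : V) (R : ℝ) (hR0 : 0 ≤ R) (hR : ∀ t, R ^ 2 ≤ t → h t = 0)
    (hΩ : closedBall a R ⊆ (Ω : Set V)) :
    ⇑(radialTestForm Ω q h hh a R hR0 hR hΩ) = radialForm q h a := rfl

/-- **The derivative of `β_h`** (product and chain rules):
`Dβ_h(x) = h(ρ) · (v ↦ ι_v K) + (h'(ρ) · 2⟨x - a, ·⟩) ⊗ ι_{x-a} K`, `ρ = ‖x - a‖²`, for the real inner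
product `Re ⟪·,·⟫`. [folklore] -/
theorem hasFDerivAt_radialForm {h : ℝ → ℝ} (a x : V) (hh : DifferentiableAt ℝ h (‖x - a‖ ^ 2)) :
    letI : InnerProductSpace ℝ V := InnerProductSpace.complexToReal
    HasFDerivAt (radialForm q h a)
      (h (‖x - a‖ ^ 2) • (kaehlerPow (q + 1) : V [⋀^Fin (2 * q + 1 + 1)]→L[ℝ] ℝ).curryLeft +
        (deriv h (‖x - a‖ ^ 2) • ((2 : ℝ) • innerSL ℝ (x - a))).smulRight
          ((kaehlerPow (q + 1) : V [⋀^Fin (2 * q + 1 + 1)]→L[ℝ] ℝ).curryLeft (x - a))) x := by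
  letI : InnerProductSpace ℝ V := InnerProductSpace.complexToReal
  have hsub : HasFDerivAt (fun y : V => y - a) (ContinuousLinearMap.id ℝ V) x :=
    (hasFDerivAt_id x).sub_const a
  have hρ : HasFDerivAt (fun y : V => ‖y - a‖ ^ 2) ((2 : ℝ) • innerSL ℝ (x - a)) x := by
    refine hsub.norm_sq.congr_fderiv ?_
    ext v
    simp [two_smul]
  have hc : HasFDerivAt (fun y : V => h (‖y - a‖ ^ 2))
      (deriv h (‖x - a‖ ^ 2) • ((2 : ℝ) • innerSL ℝ (x - a))) x :=
    hh.hasDerivAt.comp_hasFDerivAt x hρ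
  have hf : HasFDerivAt
      (fun y : V => (kaehlerPow (q + 1) : V [⋀^Fin (2 * q + 1 + 1)]→L[ℝ] ℝ).curryLeft (y - a))
      ((kaehlerPow (q + 1) : V [⋀^Fin (2 * q + 1 + 1)]→L[ℝ] ℝ).curryLeft) x := by
    have := ((kaehlerPow (q + 1) : V [⋀^Fin (2 * q + 1 + 1)]→L[ℝ] ℝ).curryLeft.hasFDerivAt).comp
      x hsub
    rwa [ContinuousLinearMap.comp_id] at this
  exact hc.smul hf

/-- **`dβ_h` on a complex frame.** For a unitary `(q+1)`-frame `u`, at every point `x`,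
`dβ_h(x)(u₀, I u₀, …) = 2 h'(ρ) · Σ_j |⟪u_j, x - a⟫|² + (2q+2) h(ρ)`, `ρ = ‖x - a‖²`: the
`h(ρ)`-term is `h(ρ) · 2(q+1) K_{q+1}(ξ) = 2(q+1) h(ρ)` (Mathlib's `alternatizeUncurryFin_curryLeft`
and Wirtinger's equality), the `h'(ρ)`-term is `2h'(ρ) Σ_i (-1)^i Re⟪x-a, ξ_i⟫ K(x-a, ξ∖i) = 2h'(ρ)|x_T|²`
(`sum_neg_one_pow_mul_re_inner_mul_kaehlerPow_vecCons`). This is the integrand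
`(dχ ∧ ι_E ω^p/p! + 2p χ ω^p/p!)|_{T_x A}` of the monotonicity computation.
[cite: Chirka1989, §15.1 (proof of Prop. 1)] -/
theorem extDeriv_radialForm_apply_complexFrame {h : ℝ → ℝ} (a x : V)
    (hh : DifferentiableAt ℝ h (‖x - a‖ ^ 2)) {u : Fin (q + 1) → V} (hu : Orthonormal ℂ u) :
    extDeriv (radialForm q h a) x (complexFrame u) =
      2 * deriv h (‖x - a‖ ^ 2) * (∑ j, ‖⟪u j, x - a⟫_ℂ‖ ^ 2) +
        (2 * q + 2) * h (‖x - a‖ ^ 2) := by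
  letI : InnerProductSpace ℝ V := InnerProductSpace.complexToReal
  set K : V [⋀^Fin (2 * q + 1 + 1)]→L[ℝ] ℝ := kaehlerPow (q + 1) with hK
  set ξ : Fin (2 * q + 1 + 1) → V := complexFrame u with hξ
  have hKξ : K ξ = 1 := kaehlerPow_complexFrame (q + 1) u hu
  simp only [extDeriv, (hasFDerivAt_radialForm a x hh).fderiv]
  rw [ContinuousAlternatingMap.alternatizeUncurryFin_add,
    ContinuousAlternatingMap.alternatizeUncurryFin_smul,
    ContinuousAlternatingMap.alternatizeUncurryFin_curryLeft, ContinuousAlternatingMap.add_apply,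
    ContinuousAlternatingMap.smul_apply, ContinuousAlternatingMap.smul_apply, hKξ,
    ContinuousAlternatingMap.alternatizeUncurryFin_apply]
  simp only [ContinuousLinearMap.smulRight_apply, FunLike.coe_smul, Pi.smul_apply, coe_innerSL_apply,
    RCLike.re_to_complex,
    ContinuousAlternatingMap.smul_apply, ContinuousAlternatingMap.curryLeft_apply_apply, smul_eq_mul,
    real_inner_eq_re_inner, zsmul_eq_mul, Int.cast_pow, Int.cast_neg, Int.cast_one]
  have hC := sum_neg_one_pow_mul_re_inner_mul_kaehlerPow_vecCons hu (x - a)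
  have hsum : (∑ i : Fin (2 * q + 1 + 1), (-1 : ℝ) ^ (i : ℕ) *
      (deriv h (‖x - a‖ ^ 2) * (2 * (⟪x - a, ξ i⟫_ℂ).re) *
        kaehlerPow (q + 1) (Matrix.vecCons (x - a) (i.removeNth ξ)))) =
      2 * deriv h (‖x - a‖ ^ 2) * ∑ i : Fin (2 * q + 1 + 1), (-1 : ℝ) ^ (i : ℕ) *
        (⟪x - a, ξ i⟫_ℂ).re * kaehlerPow (q + 1) (Matrix.vecCons (x - a) (i.removeNth ξ)) := by
    rw [Finset.mul_sum]
    exact Finset.sum_congr rfl fun i _ => by ring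
  rw [hsum, hC, nsmul_eq_mul]
  push_cast
  ring

end Radial

end Literature.Geometry.Kaehler

end
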